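import Literature.MathematicalPhysics.QuantumManyBody.GroundStateFeynmanKacOperator
import Literature.MathematicalPhysics.QuantumManyBody.GroundStateFeynmanKacSymmetry
import Mathlib.Analysis.InnerProductSpace.Adjoint
import Mathlib.MeasureTheory.Function.LpOrder
import HarnessLib

/-!
# Ground-state Feynman–Kac: self-adjointness, semigroup law and positivity of `e^{-tH_N}` on `L²(Λ)`

Topic `Literature/MathematicalPhysics/QuantumManyBody`; theorems only. Step of the proof of the
named fact `Literature.MathematicalPhysics.QuantumManyBody.BoseGas.GroundStateFeynmanKac`: the
operator-level properties of `fkL2 v L t` (`GroundStateFeynmanKacOperator.lean`) on the real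
Hilbert space `L²(Λ_L^N)` behind the Perron–Frobenius argument (Chung–Zhao (1995), Thm 3.10 /
Thm 3.17: `{T_t}` is a semigroup of positive, symmetric (self-adjoint) contractions on `L²(D)`;
Reed–Simon IV §XIII.12):

* `setIntegral_mul_fkReal_comm` — `∫_Λ g · e^{-tH} f = ∫_Λ f · e^{-tH} g` for real `f, g ∈ L²(Λ)`
  (from the path-space symmetry `lintegral_mul_fkSemigroup_comm` by splitting into positive and
  negative parts), `inner_fkL2_comm`, `isSelfAdjoint_fkL2`;
* `fkReal_add_time`, `fkL2_add_time` — `e^{-(s+t)H} = e^{-sH} e^{-tH}` (`s, t > 0`) from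
  `fkSemigroup_add`;
* `fkReal_nonneg`, `abs_fkReal_le`, `fkL2_nonneg`, `abs_fkL2_le` — positivity preservation
  `f ≥ 0 ⇒ e^{-tH} f ≥ 0` and `|e^{-tH} f| ≤ e^{-tH} |f|`;
* `inner_fkL2_self_nonneg` — `⟪e^{-tH} g, g⟫ = ‖e^{-tH/2} g‖² ≥ 0`.

## References

* K. L. Chung, Z. Zhao, *From Brownian Motion to Schrödinger's Equation* (1995), Thm 3.10,
  Thm 3.17. [ChungZhao1995]
* M. Reed, B. Simon, *Methods of Modern Mathematical Physics IV* (1978), §XIII.12.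
-/

noncomputable section

namespace Literature.MathematicalPhysics.QuantumManyBody.BoseGas

open MeasureTheory ProbabilityTheory Filter Set
open scoped ENNReal NNReal Topology InnerProductSpace
open Literature.Probability.Process

variable {N : ℕ}

/-! ### Positivity preservation -/

/-- **`f ≥ 0 ⇒ e^{-tH} f ≥ 0`** pointwise. [folklore] -/
theorem fkReal_nonneg (v : ℝ → ℝ≥0∞) (L t : ℝ) {f : Config N → ℝ} (hf : ∀ Y, 0 ≤ f Y)
    (X : Config N) : 0 ≤ fkReal v L t f X :=
  integral_nonneg fun _ => mul_nonneg ENNReal.toReal_nonneg (hf _)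

/-- **Monotonicity** `f ≤ g ⇒ e^{-tH} f ≤ e^{-tH} g` pointwise (integrable integrands).
[folklore] -/
theorem fkReal_mono {v : ℝ → ℝ≥0∞} (hv : Measurable v) (L : ℝ) {t : ℝ} (ht : 0 < t)
    {f g : Config N → ℝ} (hf : Measurable f) (hg : Measurable g)
    (hf2 : ∫⁻ Y in boxN N L, ‖f Y‖ₑ ^ (2 : ℝ) ≠ ⊤) (hg2 : ∫⁻ Y in boxN N L, ‖g Y‖ₑ ^ (2 : ℝ) ≠ ⊤)
    (hfg : ∀ Y, f Y ≤ g Y) (X : Config N) : fkReal v L t f X ≤ fkReal v L t g X :=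
  integral_mono (integrable_fkIntegrand hv L ht hf hf2 X) (integrable_fkIntegrand hv L ht hg hg2 X)
    fun _ => mul_le_mul_of_nonneg_left (hfg _) ENNReal.toReal_nonneg

/-- **`|e^{-tH} f| ≤ e^{-tH} |f|`** pointwise. [folklore] -/
theorem abs_fkReal_le (v : ℝ → ℝ≥0∞) (L t : ℝ) (f : Config N → ℝ) (X : Config N) :
    |fkReal v L t f X| ≤ fkReal v L t (fun Y => |f Y|) X := by
  refine (abs_integral_le_integral_abs).trans (le_of_eq ?_)
  refine integral_congr_ae (Eventually.of_forall fun ω => ?_)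
  simp only [abs_mul, abs_of_nonneg ENNReal.toReal_nonneg]

/-! ### Positive and negative parts of a real observable -/

/-- The positive part `f⁺ = max f 0` has no more `L²(Λ)` mass than `f`. [folklore] -/
theorem setLIntegral_enorm_posPart_sq_ne_top (L : ℝ) {f : Config N → ℝ}
    (hf2 : ∫⁻ Y in boxN N L, ‖f Y‖ₑ ^ (2 : ℝ) ≠ ⊤) :
    ∫⁻ Y in boxN N L, ‖max (f Y) 0‖ₑ ^ (2 : ℝ) ≠ ⊤ := by
  refine ne_top_of_le_ne_top hf2 (lintegral_mono fun Y => ?_)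
  refine ENNReal.rpow_le_rpow ?_ (by norm_num)
  rw [Real.enorm_of_nonneg (le_max_right _ _), Real.enorm_eq_ofReal_abs]
  exact ENNReal.ofReal_le_ofReal (max_le (le_abs_self _) (abs_nonneg _))

/-- The negative part `f⁻ = max (-f) 0` has no more `L²(Λ)` mass than `f`. [folklore] -/
theorem setLIntegral_enorm_negPart_sq_ne_top (L : ℝ) {f : Config N → ℝ}
    (hf2 : ∫⁻ Y in boxN N L, ‖f Y‖ₑ ^ (2 : ℝ) ≠ ⊤) :
    ∫⁻ Y in boxN N L, ‖max (-f Y) 0‖ₑ ^ (2 : ℝ) ≠ ⊤ := by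
  have h : ∫⁻ Y in boxN N L, ‖(-f) Y‖ₑ ^ (2 : ℝ) ≠ ⊤ := by simpa using hf2
  exact setLIntegral_enorm_posPart_sq_ne_top L h

/-- The absolute value `|f|` has the `L²(Λ)` mass of `f`. [folklore] -/
theorem setLIntegral_enorm_abs_sq (L : ℝ) (f : Config N → ℝ) :
    ∫⁻ Y in boxN N L, ‖|f Y|‖ₑ ^ (2 : ℝ) = ∫⁻ Y in boxN N L, ‖f Y‖ₑ ^ (2 : ℝ) := by
  simp_rw [Real.enorm_abs]

/-- `f = f⁺ - f⁻`. [folklore] -/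
theorem posPart_sub_negPart (f : Config N → ℝ) :
    (fun Y => max (f Y) 0) - (fun Y => max (-f Y) 0) = f := by
  funext Y
  simp only [Pi.sub_apply]
  exact max_zero_sub_max_neg_zero_eq_self (f Y)

/-- **Linearity over the decomposition `f = f⁺ - f⁻`**: `e^{-tH} f = e^{-tH} f⁺ - e^{-tH} f⁻`
(`t > 0`, `f ∈ L²(Λ)`). [folklore] -/
theorem fkReal_eq_posPart_sub_negPart {v : ℝ → ℝ≥0∞} (hv : Measurable v) (L : ℝ) {t : ℝ}
    (ht : 0 < t) {f : Config N → ℝ} (hf : Measurable f)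
    (hf2 : ∫⁻ Y in boxN N L, ‖f Y‖ₑ ^ (2 : ℝ) ≠ ⊤) (X : Config N) :
    fkReal v L t f X = fkReal v L t (fun Y => max (f Y) 0) X -
      fkReal v L t (fun Y => max (-f Y) 0) X := by
  have hp : Measurable fun Y => max (f Y) 0 := hf.max measurable_const
  have hn : Measurable fun Y => max (-f Y) 0 := hf.neg.max measurable_const
  conv_lhs => rw [← posPart_sub_negPart f]
  rw [sub_eq_add_neg, fkReal_add hv L ht hp hn.neg (setLIntegral_enorm_posPart_sq_ne_top L hf2)
    (by simpa using setLIntegral_enorm_negPart_sq_ne_top L hf2) X]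
  rw [show (-fun Y => max (-f Y) 0) = (-1 : ℝ) • fun Y => max (-f Y) 0 by simp, fkReal_smul]
  ring

/-! ### Symmetry on `L²(Λ)` -/

/-- The product of an `L²(Λ)` observable with the transform of another is integrable on `Λ`
(`t ≥ 0`). [folklore] -/
theorem integrable_mul_fkReal {v : ℝ → ℝ≥0∞} (hv : Measurable v) (L : ℝ) {t : ℝ} (ht : 0 ≤ t)
    {f g : Config N → ℝ} (hf : Measurable f) (hg : Measurable g)
    (hf2 : ∫⁻ Y in boxN N L, ‖f Y‖ₑ ^ (2 : ℝ) ≠ ⊤) (hg2 : ∫⁻ Y in boxN N L, ‖g Y‖ₑ ^ (2 : ℝ) ≠ ⊤) :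
    Integrable (fun X => g X * fkReal v L t f X) (volume.restrict (boxN N L)) := by
  have hgm : MemLp g 2 (volume.restrict (boxN N L)) := by
    refine ⟨hg.aestronglyMeasurable, ?_⟩
    rw [eLpNorm_two_eq]
    exact ENNReal.rpow_lt_top_of_nonneg (by norm_num) hg2
  have hRm : MemLp (fkReal v L t f) 2 (volume.restrict (boxN N L)) := by
    refine ⟨(measurable_fkReal hv L t hf).aestronglyMeasurable, ?_⟩
    rw [eLpNorm_two_eq]
    refine ENNReal.rpow_lt_top_of_nonneg (by norm_num) (ne_top_of_le_ne_top hf2 ?_)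
    exact setLIntegral_enorm_fkReal_sq_le hv L ht hf
  exact hgm.integrable_mul hRm

/-- **Symmetry for nonnegative observables**: `∫_Λ g · e^{-tH} f = ∫_Λ f · e^{-tH} g` for
measurable `f, g ≥ 0` in `L²(Λ)`, `t > 0` (path-space symmetry `lintegral_mul_fkSemigroup_comm`,
read in `ℝ`). [folklore] -/
theorem setIntegral_mul_fkReal_comm_of_nonneg {v : ℝ → ℝ≥0∞} (hv : Measurable v) (L : ℝ) {t : ℝ}
    (ht : 0 < t) {f g : Config N → ℝ} (hf : Measurable f) (hg : Measurable g)
    (hf0 : ∀ Y, 0 ≤ f Y) (hg0 : ∀ Y, 0 ≤ g Y)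
    (hf2 : ∫⁻ Y in boxN N L, ‖f Y‖ₑ ^ (2 : ℝ) ≠ ⊤) (hg2 : ∫⁻ Y in boxN N L, ‖g Y‖ₑ ^ (2 : ℝ) ≠ ⊤) :
    ∫ X in boxN N L, g X * fkReal v L t f X = ∫ X in boxN N L, f X * fkReal v L t g X := by
  -- both sides as `toReal` of `[0, ∞]`-integrals
  have key : ∀ {a b : Config N → ℝ}, Measurable a → Measurable b → (∀ Y, 0 ≤ a Y) →
      (∀ Y, 0 ≤ b Y) → ∫⁻ Y in boxN N L, ‖a Y‖ₑ ^ (2 : ℝ) ≠ ⊤ →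
      ∫⁻ Y in boxN N L, ‖b Y‖ₑ ^ (2 : ℝ) ≠ ⊤ →
      ∫ X in boxN N L, b X * fkReal v L t a X =
        (∫⁻ X, (boxN N L).indicator (fun Y => ENNReal.ofReal (b Y)) X *
          fkSemigroup v L t ((boxN N L).indicator fun Y => ENNReal.ofReal (a Y)) X).toReal := by
    intro a b ha hb ha0 hb0 ha2 hb2
    rw [integral_eq_lintegral_of_nonneg_ae (Eventually.of_forall fun X =>
        mul_nonneg (hb0 X) (fkReal_nonneg v L t ha0 X))
      ((hb.mul (measurable_fkReal hv L t ha)).aestronglyMeasurable)]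
    congr 1
    rw [← lintegral_indicator (measurableSet_boxN N L)]
    refine lintegral_congr fun X => ?_
    rw [fkSemigroup_indicator v L ht.le]
    by_cases hX : X ∈ boxN N L
    · rw [Set.indicator_of_mem hX, Set.indicator_of_mem hX,
        ENNReal.ofReal_mul (hb0 X), fkReal_eq_toReal_fkSemigroup hv L t ha ha0,
        ENNReal.ofReal_toReal]
      rw [← fkSemigroup_indicator v L ht.le]
      refine (fkSemigroup_lt_top v L ht ((Measurable.ennreal_ofReal ha).indicator
        (measurableSet_boxN N L)) ?_ X).ne
      rw [← lintegral_indicator (measurableSet_boxN N L)] at ha2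
      convert ha2 using 1
      refine lintegral_congr fun Y => ?_
      by_cases hY : Y ∈ boxN N L
      · simp [Set.indicator_of_mem hY, Real.enorm_of_nonneg (ha0 Y)]
      · simp [Set.indicator_of_notMem hY]
    · rw [Set.indicator_of_notMem hX, Set.indicator_of_notMem hX, zero_mul]
  rw [key hf hg hf0 hg0 hf2 hg2, key hg hf hg0 hf0 hg2 hf2,
    lintegral_mul_fkSemigroup_comm hv L ht.le
      ((Measurable.ennreal_ofReal hg).indicator (measurableSet_boxN N L))
      ((Measurable.ennreal_ofReal hf).indicator (measurableSet_boxN N L))]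

/-- **Symmetry of `e^{-tH_N}` on `L²(Λ_L^N)`**: `∫_Λ g · e^{-tH} f = ∫_Λ f · e^{-tH} g` for real
measurable `f, g` square integrable on the box, `t > 0` (positive/negative parts and bilinearity).
Chung–Zhao (1995), Thm 3.10 / Thm 3.17 (symmetric kernel). [cite: ChungZhao1995, Thm 3.10 and Thm 3.17] -/
theorem setIntegral_mul_fkReal_comm {v : ℝ → ℝ≥0∞} (hv : Measurable v) (L : ℝ) {t : ℝ}
    (ht : 0 < t) {f g : Config N → ℝ} (hf : Measurable f) (hg : Measurable g)
    (hf2 : ∫⁻ Y in boxN N L, ‖f Y‖ₑ ^ (2 : ℝ) ≠ ⊤) (hg2 : ∫⁻ Y in boxN N L, ‖g Y‖ₑ ^ (2 : ℝ) ≠ ⊤) :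
    ∫ X in boxN N L, g X * fkReal v L t f X = ∫ X in boxN N L, f X * fkReal v L t g X := by
  -- the four parts
  set fp : Config N → ℝ := fun Y => max (f Y) 0 with hfp
  set fn : Config N → ℝ := fun Y => max (-f Y) 0 with hfn
  set gp : Config N → ℝ := fun Y => max (g Y) 0 with hgp
  set gn : Config N → ℝ := fun Y => max (-g Y) 0 with hgn
  have mfp : Measurable fp := hf.max measurable_const
  have mfn : Measurable fn := hf.neg.max measurable_const
  have mgp : Measurable gp := hg.max measurable_const
  have mgn : Measurable gn := hg.neg.max measurable_const
  have ifp := setLIntegral_enorm_posPart_sq_ne_top L hf2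
  have ifn := setLIntegral_enorm_negPart_sq_ne_top L hf2
  have igp := setLIntegral_enorm_posPart_sq_ne_top L hg2
  have ign := setLIntegral_enorm_negPart_sq_ne_top L hg2
  have p0 : ∀ (h : Config N → ℝ) (Y : Config N), 0 ≤ max (h Y) 0 := fun h Y => le_max_right _ _
  -- expand both sides
  have hL : ∀ X, g X * fkReal v L t f X =
      (gp X * fkReal v L t fp X - gp X * fkReal v L t fn X) -
        (gn X * fkReal v L t fp X - gn X * fkReal v L t fn X) := by
    intro X
    rw [fkReal_eq_posPart_sub_negPart hv L ht hf hf2 X]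
    have hg' : g X = gp X - gn X := (max_zero_sub_max_neg_zero_eq_self (g X)).symm
    rw [hg']
    ring
  have hR : ∀ X, f X * fkReal v L t g X =
      (fp X * fkReal v L t gp X - fp X * fkReal v L t gn X) -
        (fn X * fkReal v L t gp X - fn X * fkReal v L t gn X) := by
    intro X
    rw [fkReal_eq_posPart_sub_negPart hv L ht hg hg2 X]
    have hf' : f X = fp X - fn X := (max_zero_sub_max_neg_zero_eq_self (f X)).symm
    rw [hf']
    ring
  simp_rw [hL, hR]
  have I := fun {a b : Config N → ℝ} (ha : Measurable a) (hb : Measurable b)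
    (ha2 : ∫⁻ Y in boxN N L, ‖a Y‖ₑ ^ (2 : ℝ) ≠ ⊤) (hb2 : ∫⁻ Y in boxN N L, ‖b Y‖ₑ ^ (2 : ℝ) ≠ ⊤) =>
    integrable_mul_fkReal hv L ht.le ha hb ha2 hb2
  have HL1 : Integrable (fun X => gp X * fkReal v L t fp X - gp X * fkReal v L t fn X)
      (volume.restrict (boxN N L)) := (I mfp mgp ifp igp).sub (I mfn mgp ifn igp)
  have HL2 : Integrable (fun X => gn X * fkReal v L t fp X - gn X * fkReal v L t fn X)
      (volume.restrict (boxN N L)) := (I mfp mgn ifp ign).sub (I mfn mgn ifn ign)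
  have HR1 : Integrable (fun X => fp X * fkReal v L t gp X - fp X * fkReal v L t gn X)
      (volume.restrict (boxN N L)) := (I mgp mfp igp ifp).sub (I mgn mfp ign ifp)
  have HR2 : Integrable (fun X => fn X * fkReal v L t gp X - fn X * fkReal v L t gn X)
      (volume.restrict (boxN N L)) := (I mgp mfn igp ifn).sub (I mgn mfn ign ifn)
  rw [integral_sub HL1 HL2, integral_sub (I mfp mgp ifp igp) (I mfn mgp ifn igp),
    integral_sub (I mfp mgn ifp ign) (I mfn mgn ifn ign),
    integral_sub HR1 HR2, integral_sub (I mgp mfp igp ifp) (I mgn mfp ign ifp),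
    integral_sub (I mgp mfn igp ifn) (I mgn mfn ign ifn),
    setIntegral_mul_fkReal_comm_of_nonneg hv L ht mfp mgp (p0 f) (p0 g) ifp igp,
    setIntegral_mul_fkReal_comm_of_nonneg hv L ht mfn mgp (p0 _) (p0 g) ifn igp,
    setIntegral_mul_fkReal_comm_of_nonneg hv L ht mfp mgn (p0 f) (p0 _) ifp ign,
    setIntegral_mul_fkReal_comm_of_nonneg hv L ht mfn mgn (p0 _) (p0 _) ifn ign]
  ring

/-- **`⟪e^{-tH} f, g⟫ = ⟪f, e^{-tH} g⟫` on `L²(Λ_L^N)`** (`t > 0`, measurable `v`). [folklore] -/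
theorem inner_fkL2_comm {v : ℝ → ℝ≥0∞} (hv : Measurable v) (L : ℝ) {t : ℝ} (ht : 0 < t)
    (f g : Lp ℝ 2 (volume.restrict (boxN N L))) :
    ⟪fkL2 v L t f, g⟫_ℝ = ⟪f, fkL2 v L t g⟫_ℝ := by
  rw [L2.inner_def, L2.inner_def]
  have h1 : ∫ X, ⟪(fkL2 v L t f : Config N → ℝ) X, g X⟫_ℝ ∂volume.restrict (boxN N L) =
      ∫ X in boxN N L, g X * fkReal v L t f X := by
    refine integral_congr_ae ?_
    filter_upwards [fkL2_coeFn hv L ht f] with X hX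
    rw [hX, RCLike.inner_apply, conj_trivial]
  have h2 : ∫ X, ⟪(f : Config N → ℝ) X, (fkL2 v L t g : Config N → ℝ) X⟫_ℝ
      ∂volume.restrict (boxN N L) = ∫ X in boxN N L, f X * fkReal v L t g X := by
    refine integral_congr_ae ?_
    filter_upwards [fkL2_coeFn hv L ht g] with X hX
    rw [hX, RCLike.inner_apply, conj_trivial, mul_comm]
  rw [h1, h2]
  exact setIntegral_mul_fkReal_comm hv L ht (measurable_coeFn_Lp f) (measurable_coeFn_Lp g)
    (setLIntegral_enorm_sq_ne_top f) (setLIntegral_enorm_sq_ne_top g)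

/-- **`e^{-tH_N}` is self-adjoint on `L²(Λ_L^N)`** (`t > 0`, measurable `v`). Chung–Zhao (1995),
Thm 3.17 / Prop 3.29 (self-adjointness of the Feynman–Kac semigroup on `L²(D)`).
[cite: ChungZhao1995, Thm 3.17] -/
theorem isSelfAdjoint_fkL2 {v : ℝ → ℝ≥0∞} (hv : Measurable v) (L : ℝ) {t : ℝ} (ht : 0 < t) :
    IsSelfAdjoint (fkL2 v L t :
      Lp ℝ 2 (volume.restrict (boxN N L)) →L[ℝ] Lp ℝ 2 (volume.restrict (boxN N L))) := by
  rw [ContinuousLinearMap.isSelfAdjoint_iff_isSymmetric]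
  intro f g
  exact inner_fkL2_comm hv L ht f g

/-! ### The semigroup law on `L²(Λ)` -/

/-- **`e^{-(s+t)H} a = e^{-sH} (e^{-tH} a)` for nonnegative `a ∈ L²(Λ)`** (`s, t > 0`), from the
semigroup law of the `[0, ∞]`-valued functional. [folklore] -/
theorem fkReal_add_time_of_nonneg {v : ℝ → ℝ≥0∞} (hv : Measurable v) (L : ℝ) {s t : ℝ}
    (hs : 0 < s) (ht : 0 < t) {a : Config N → ℝ} (ha : Measurable a) (ha0 : ∀ Y, 0 ≤ a Y)
    (ha2 : ∫⁻ Y in boxN N L, ‖a Y‖ₑ ^ (2 : ℝ) ≠ ⊤) (X : Config N) :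
    fkReal v L (s + t) a X = fkReal v L s (fkReal v L t a) X := by
  set A : Config N → ℝ≥0∞ := (boxN N L).indicator fun Y => ENNReal.ofReal (a Y) with hA
  have hAm : Measurable A := (Measurable.ennreal_ofReal ha).indicator (measurableSet_boxN N L)
  have hA2 : ∫⁻ Y, A Y ^ (2 : ℝ) ≠ ⊤ := by
    rw [hA, ← lintegral_indicator (measurableSet_boxN N L)] at *
    convert ha2 using 1
    refine lintegral_congr fun Y => ?_
    by_cases hY : Y ∈ boxN N L
    · simp [Set.indicator_of_mem hY, Real.enorm_of_nonneg (ha0 Y)]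
    · simp [Set.indicator_of_notMem hY]
  -- `fkReal r a = toReal ∘ fkSemigroup r A`
  have hra : ∀ {r : ℝ}, 0 ≤ r → ∀ Y, fkReal v L r a Y = (fkSemigroup v L r A Y).toReal := by
    intro r hr Y
    rw [fkReal_eq_toReal_fkSemigroup hv L r ha ha0, hA, fkSemigroup_indicator v L hr]
  have hfin : ∀ Y, fkSemigroup v L t A Y ≠ ⊤ := fun Y => (fkSemigroup_lt_top v L ht hAm hA2 Y).ne
  -- the transform of `fkReal t a`, a nonnegative measurable function
  have hm : Measurable (fkReal v L t a) := measurable_fkReal hv L t ha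
  have h0 : ∀ Y, 0 ≤ fkReal v L t a Y := fun Y => fkReal_nonneg v L t ha0 Y
  rw [fkReal_eq_toReal_fkSemigroup hv L s hm h0, hra (add_pos hs ht).le,
    fkSemigroup_add hv L hs.le ht.le hAm]
  congr 1
  refine lintegral_congr fun ω => ?_
  congr 1
  dsimp only
  rw [hra ht.le, ENNReal.ofReal_toReal (hfin _)]

/-- **Subtractivity** of the real functional on `L²(Λ)` observables (`t > 0`). [folklore] -/
theorem fkReal_sub {v : ℝ → ℝ≥0∞} (hv : Measurable v) (L : ℝ) {t : ℝ} (ht : 0 < t)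
    {f g : Config N → ℝ} (hf : Measurable f) (hg : Measurable g)
    (hf2 : ∫⁻ Y in boxN N L, ‖f Y‖ₑ ^ (2 : ℝ) ≠ ⊤) (hg2 : ∫⁻ Y in boxN N L, ‖g Y‖ₑ ^ (2 : ℝ) ≠ ⊤)
    (X : Config N) : fkReal v L t (f - g) X = fkReal v L t f X - fkReal v L t g X := by
  rw [sub_eq_add_neg, fkReal_add hv L ht hf hg.neg hf2 (by simpa using hg2) X,
    show -g = (-1 : ℝ) • g by simp, fkReal_smul]
  ring

/-- **The semigroup law `e^{-(s+t)H} f = e^{-sH} (e^{-tH} f)` for real `f ∈ L²(Λ)`**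
(`s, t > 0`; positive and negative parts). [folklore] -/
theorem fkReal_add_time {v : ℝ → ℝ≥0∞} (hv : Measurable v) (L : ℝ) {s t : ℝ} (hs : 0 < s)
    (ht : 0 < t) {f : Config N → ℝ} (hf : Measurable f)
    (hf2 : ∫⁻ Y in boxN N L, ‖f Y‖ₑ ^ (2 : ℝ) ≠ ⊤) (X : Config N) :
    fkReal v L (s + t) f X = fkReal v L s (fkReal v L t f) X := by
  have mfp : Measurable fun Y => max (f Y) 0 := hf.max measurable_const
  have mfn : Measurable fun Y => max (-f Y) 0 := hf.neg.max measurable_const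
  have ifp := setLIntegral_enorm_posPart_sq_ne_top L hf2
  have ifn := setLIntegral_enorm_negPart_sq_ne_top L hf2
  have p0 : ∀ (h : Config N → ℝ) (Y : Config N), 0 ≤ max (h Y) 0 := fun h Y => le_max_right _ _
  -- `fkReal t f = fkReal t f⁺ - fkReal t f⁻`, both summands in `L²(Λ)`
  have hdec : fkReal v L t f = fkReal v L t (fun Y => max (f Y) 0) -
      fkReal v L t (fun Y => max (-f Y) 0) :=
    funext fun Y => fkReal_eq_posPart_sub_negPart hv L ht hf hf2 Y
  have i1 : ∫⁻ Y in boxN N L, ‖fkReal v L t (fun Y => max (f Y) 0) Y‖ₑ ^ (2 : ℝ) ≠ ⊤ :=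
    ne_top_of_le_ne_top ifp (setLIntegral_enorm_fkReal_sq_le hv L ht.le mfp)
  have i2 : ∫⁻ Y in boxN N L, ‖fkReal v L t (fun Y => max (-f Y) 0) Y‖ₑ ^ (2 : ℝ) ≠ ⊤ :=
    ne_top_of_le_ne_top ifn (setLIntegral_enorm_fkReal_sq_le hv L ht.le mfn)
  rw [fkReal_eq_posPart_sub_negPart hv L (add_pos hs ht) hf hf2, hdec,
    fkReal_sub hv L hs (measurable_fkReal hv L t mfp) (measurable_fkReal hv L t mfn) i1 i2,
    fkReal_add_time_of_nonneg hv L hs ht mfp (p0 f) ifp,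
    fkReal_add_time_of_nonneg hv L hs ht mfn (p0 _) ifn]

/-- **`e^{-(s+t)H_N} = e^{-sH_N} ∘ e^{-tH_N}` as operators on `L²(Λ_L^N)`** (`s, t > 0`,
measurable `v`). Chung–Zhao (1995), §3.2 (semigroup property). [cite: ChungZhao1995, §3.2 (before Thm 3.10)] -/
theorem fkL2_add_time {v : ℝ → ℝ≥0∞} (hv : Measurable v) (L : ℝ) {s t : ℝ} (hs : 0 < s)
    (ht : 0 < t) :
    (fkL2 v L (s + t) : Lp ℝ 2 (volume.restrict (boxN N L)) →L[ℝ] _) =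
      (fkL2 v L s).comp (fkL2 v L t) := by
  ext1 g
  rw [ContinuousLinearMap.comp_apply, fkL2_apply hv L (add_pos hs ht), fkL2_apply hv L hs]
  refine MemLp.toLp_congr _ _ (Eventually.of_forall fun X => ?_)
  rw [fkReal_add_time hv L hs ht (measurable_coeFn_Lp g) (setLIntegral_enorm_sq_ne_top g) X]
  exact (fkReal_congr_ae_restrict v L hs (fkL2_coeFn hv L ht g) X).symm

/-- Iterating: `e^{-tH} = (e^{-(t/2)H})²`. [folklore] -/
theorem fkL2_eq_comp_half {v : ℝ → ℝ≥0∞} (hv : Measurable v) (L : ℝ) {t : ℝ} (ht : 0 < t) :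
    (fkL2 v L t : Lp ℝ 2 (volume.restrict (boxN N L)) →L[ℝ] _) =
      (fkL2 v L (t / 2)).comp (fkL2 v L (t / 2)) := by
  rw [← fkL2_add_time hv L (half_pos ht) (half_pos ht), add_halves]

/-! ### Positivity on `L²(Λ)` -/

/-- **Positivity preservation on `L²(Λ)`**: `0 ≤ g ⇒ 0 ≤ e^{-tH} g`. [folklore] -/
theorem fkL2_nonneg {v : ℝ → ℝ≥0∞} (hv : Measurable v) (L : ℝ) {t : ℝ} (ht : 0 < t)
    {g : Lp ℝ 2 (volume.restrict (boxN N L))} (hg : 0 ≤ g) : 0 ≤ fkL2 v L t g := by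
  rw [← Lp.coeFn_nonneg] at hg ⊢
  have hrep : (g : Config N → ℝ) =ᵐ[volume.restrict (boxN N L)] fun Y => max (g Y) 0 := by
    filter_upwards [hg] with Y hY
    exact (max_eq_left hY).symm
  filter_upwards [fkL2_coeFn hv L ht g] with X hX
  rw [hX, fkReal_congr_ae_restrict v L ht hrep X]
  exact fkReal_nonneg v L t (fun Y => le_max_right _ _) X

/-- **`|e^{-tH} g| ≤ e^{-tH} |g|` on `L²(Λ)`** (lattice absolute value). [folklore] -/
theorem abs_fkL2_le {v : ℝ → ℝ≥0∞} (hv : Measurable v) (L : ℝ) {t : ℝ} (ht : 0 < t)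
    (g : Lp ℝ 2 (volume.restrict (boxN N L))) : |fkL2 v L t g| ≤ fkL2 v L t |g| := by
  rw [← Lp.coeFn_le]
  filter_upwards [Lp.coeFn_abs (fkL2 v L t g), fkL2_coeFn hv L ht g, fkL2_coeFn hv L ht |g|]
    with X h1 h2 h3
  rw [h1, h2, h3, fkReal_congr_ae_restrict v L ht (Lp.coeFn_abs g) X]
  exact abs_fkReal_le v L t g X

/-- **`⟪e^{-tH} g, g⟫ = ‖e^{-(t/2)H} g‖² ≥ 0`**: the semigroup consists of positive operators.
[folklore] -/
theorem inner_fkL2_self_eq_norm_sq {v : ℝ → ℝ≥0∞} (hv : Measurable v) (L : ℝ) {t : ℝ}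
    (ht : 0 < t) (g : Lp ℝ 2 (volume.restrict (boxN N L))) :
    ⟪fkL2 v L t g, g⟫_ℝ = ‖fkL2 v L (t / 2) g‖ ^ 2 := by
  rw [fkL2_eq_comp_half hv L ht, ContinuousLinearMap.comp_apply, inner_fkL2_comm hv L (half_pos ht),
    real_inner_self_eq_norm_sq]

/-- `⟪e^{-tH} g, g⟫ ≥ 0`. [folklore] -/
theorem inner_fkL2_self_nonneg {v : ℝ → ℝ≥0∞} (hv : Measurable v) (L : ℝ) {t : ℝ} (ht : 0 < t)
    (g : Lp ℝ 2 (volume.restrict (boxN N L))) : 0 ≤ ⟪fkL2 v L t g, g⟫_ℝ := by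
  rw [inner_fkL2_self_eq_norm_sq hv L ht]
  positivity

end Literature.MathematicalPhysics.QuantumManyBody.BoseGas

end
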